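import Literature.AlgebraicGeometry.Frobenioids.CircleOpensSubarcs
import Literature.AlgebraicGeometry.Frobenioids.CircleOpensProofs
import HarnessLib

/-!
# Frobenioids II, Lemma 3.2: proofs of (vi) and (vii)

Mochizuki, *The geometry of Frobenioids II*, Kyushu J. Math. **62** (2008) 401–460, §3, Lemma 3.2
(vi), (vii) pp. 25–26 [cite: MochizukiFrdII2008, Lem 3.2 (vi) pp.25-26]. Discharges (proof-only
companion) of the named facts `ItemVI`, `ItemVII` of `CircleOpens.lean` (abc-iut-L1-t4), from the
sub-arc calculus of `CircleOpensSubarcs.lean`.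

Proof notes. (vi), `B = S¹`: `S¹ \ A` is a closed arc, hence connected, so (c) holds and (e) fails;
the `(A, S¹)`-subsets have complements inside `S¹ \ A`, so (a) holds iff `S¹ \ A` has at most one
point (two points `p ≠ q` give the incomparable `S¹ \ {p}`, `S¹ \ {q}`), i.e. iff (d); and then (b)
fails (no subset strictly between `A` and `S¹`). (vi), `B ≠ S¹`: (d), (e) hold trivially, (b) always
holds, and (a) ⇔ (c) ⇔ "`A`, `B` share an endpoint". (vii): with `A = (a, b) ⊊ B = (c, d)` take
`C = (c, b)`, `((a+c)/2, d)` or `(c, (b+d)/2)` according to which endpoints differ.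
-/

namespace Literature.AlgebraicGeometry.Frobenioids

open Set Function Topology Real
open scoped Pointwise

noncomputable section

namespace CircleOpens

/-- The complement of a proper open arc `exp(i·(a, b))`, `0 < b - a ≤ 2π`, is the closed arc
`exp(i·[b, a + 2π])`. [cite: MochizukiFrdII2008, Lem 3.2 (vi) p.26] -/
theorem univ_diff_arc {a b : ℝ} (hab : a < b) (hlen : b - a ≤ 2 * π) :
    univ \ Circle.exp '' Ioo a b = Circle.exp '' Icc b (a + 2 * π) := by
  have hinj := Circle.exp_injOn_Ioc (a := a) (b := a + 2 * π) (by linarith)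
  ext z
  simp only [mem_sdiff, mem_univ, true_and]
  constructor
  · intro hz
    -- a parameter `x ∈ (a, a + 2π]` for `z`
    obtain ⟨x, hx, rfl⟩ : ∃ x ∈ Ioc a (a + 2 * π), Circle.exp x = z := by
      by_cases h : z = Circle.exp a
      · exact ⟨a + 2 * π, ⟨by linarith [two_pi_pos], le_rfl⟩, by rw [h, Circle.exp_add_two_pi]⟩
      · have hz' : z ∈ ({Circle.exp a}ᶜ : Set Circle) := h
        rw [← exp_image_Ioo_eq_compl] at hz'
        obtain ⟨x, hx, rfl⟩ := hz'
        exact ⟨x, ⟨hx.1, hx.2.le⟩, rfl⟩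
    refine ⟨x, ⟨?_, hx.2⟩, rfl⟩
    by_contra hxb
    exact hz ⟨x, ⟨hx.1, not_le.mp hxb⟩, rfl⟩
  · rintro ⟨x, hx, rfl⟩ ⟨y, hy, hxy⟩
    have : y = x := hinj ⟨hy.1, by linarith [hy.2]⟩ ⟨by linarith [hx.1], hx.2⟩ hxy
    subst this
    linarith [hx.1, hy.2]

/-- `exp(ic) ∉ exp(i·(c, d))` for `d - c ≤ 2π`. [cite: MochizukiFrdII2008, Lem 3.2 (vi) p.26] -/
private theorem exp_left_notMem_arc {c d : ℝ} (hcd : d - c ≤ 2 * π) :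
    Circle.exp c ∉ Circle.exp '' Ioo c d := by
  rintro ⟨x, hx, hxe⟩
  exact hx.1.ne' (Circle.exp_injOn_Ico (a := c) (b := c + 2 * π) (by linarith)
    ⟨hx.1.le, by linarith [hx.2]⟩ ⟨le_rfl, by linarith [two_pi_pos]⟩ hxe)

/-- `S¹ \ {p} ⊆ S¹ \ {q}` forces `p = q`. [cite: MochizukiFrdII2008, Lem 3.2 (vi) p.26] -/
private theorem eq_of_compl_singleton_subset {p q : Circle} (h : ({p}ᶜ : Set Circle) ⊆ {q}ᶜ) :
    p = q :=
  (mem_singleton_iff.mp (singleton_subset_iff.mp (compl_subset_compl.mp h))).symm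

/-- **Lemma 3.2 (vi)** (FrdII pp. 25–26), PROVED: for `A ≠ B`, "(a) holds if and only if both (c) and
(d) hold; both (a) and (b) hold if and only if both (c) and (e) hold."
[cite: MochizukiFrdII2008, Lem 3.2 (vi) pp.25-26] -/
theorem ItemVI_holds : ItemVI := by
  intro A B hAB hne
  by_cases hB : B = univ
  · subst hB
    have hC : CondC A univ := by
      obtain ⟨a, b, hab, hlen, rfl⟩ :=
        exists_eq_exp_image_Ioo hAB.isConnected_left hAB.isOpen_left hne
      show IsPreconnected (univ \ Circle.exp '' Ioo a b)
      rw [univ_diff_arc hab hlen]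
      exact isPreconnected_Icc.image _ Circle.exp.continuous.continuousOn
    have hE : ¬ CondE A univ := fun h => h rfl
    -- subsets between `A` and `S¹` are controlled by the complement of `A`
    have key : (univ \ A).Subsingleton → ∀ C : Set Circle, IsSub A univ C → C ≠ univ → C = A := by
      intro hsub C hC hCu
      obtain ⟨p, hp⟩ := (ne_univ_iff_exists_notMem _).mp hCu
      refine le_antisymm (fun x hx => ?_) hC.2.2.1
      by_contra hxA
      have hpA : p ∈ univ \ A := ⟨trivial, fun h => hp (hC.2.2.1 h)⟩
      exact hp (hsub ⟨trivial, hxA⟩ hpA ▸ hx)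
    have hAD : CondA A univ ↔ CondD A univ := by
      constructor
      · intro hA _
        by_contra hns
        obtain ⟨p, hp, q, hq, hpq⟩ := Set.not_subsingleton_iff.mp hns
        rcases hA {p}ᶜ {q}ᶜ (isSub_compl_singleton hp.2) (isSub_compl_singleton hq.2) with h | h
        · exact hpq (eq_of_compl_singleton_subset h)
        · exact hpq (eq_of_compl_singleton_subset h).symm
      · intro hD A₁ A₂ h₁ h₂
        have hsub : (univ \ A).Subsingleton := hD rfl
        by_cases e₂ : A₂ = univ
        · exact Or.inl (e₂ ▸ subset_univ _)
        · by_cases e₁ : A₁ = univ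
          · exact Or.inr (e₁ ▸ subset_univ _)
          · rw [key hsub A₁ h₁ e₁, key hsub A₂ h₂ e₂]
            exact Or.inl subset_rfl
    refine ⟨⟨fun hA => ⟨hC, hAD.mp hA⟩, fun h => hAD.mpr h.2⟩,
      ⟨fun h => ⟨hC, ?_⟩, fun h => absurd h.2 hE⟩⟩
    -- (a) ∧ (b) is impossible when `B = S¹`
    exfalso
    obtain ⟨hA, hBc⟩ := h
    have hsub : (univ \ A).Subsingleton := hAD.mp hA rfl
    obtain ⟨A₃, h₃, h₃A, h₃u⟩ :=
      hBc A univ (isSub_left hAB) (isSub_right hAB) (subset_univ _) hne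
    exact h₃A (key hsub A₃ h₃ h₃u)
  · obtain ⟨c, d, hcd, hlen, rfl⟩ :=
      exists_eq_exp_image_Ioo hAB.isConnected_right hAB.isOpen_right hB
    have hcA : Circle.exp c ∉ A := fun h => exp_left_notMem_arc hlen (hAB.subset h)
    obtain ⟨a, b, hca, hab, hb2, rfl⟩ :=
      exists_eq_exp_image_Ioo_of_notMem hAB.isConnected_left hAB.isOpen_left hcA
    have hbd : b ≤ d :=
      ((exp_image_Ioo_subset_iff hab hca hb2 le_rfl (by linarith)).mp hAB.subset).2
    have hD : CondD (Circle.exp '' Ioo a b) (Circle.exp '' Ioo c d) := fun h => absurd h hB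
    have hE : CondE (Circle.exp '' Ioo a b) (Circle.exp '' Ioo c d) := hB
    have hBc := condB_of_arc hlen hca hab hbd
    have hAC : CondA (Circle.exp '' Ioo a b) (Circle.exp '' Ioo c d) ↔
        CondC (Circle.exp '' Ioo a b) (Circle.exp '' Ioo c d) :=
      (condA_arc_iff hlen hca hab hbd).trans (condC_arc_iff hlen hca hab hbd).symm
    exact ⟨⟨fun hA => ⟨hAC.mp hA, hD⟩, fun h => hAC.mpr h.1⟩,
      ⟨fun h => ⟨hAC.mp h.1, hE⟩, fun h => ⟨hAC.mpr h.1, hBc⟩⟩⟩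

/-! ### Lemma 3.2 (vii) -/

/-- A proper sub-arc sharing an endpoint with its containing proper arc gives a continuously
ordered pair. [cite: MochizukiFrdII2008, Lem 3.2 (vii) p.26] -/
theorem isContinuouslyOrdered_arc {c d a b : ℝ} (hcd : d - c ≤ 2 * π) (hca : c ≤ a) (hab : a < b)
    (hbd : b ≤ d) (hne : ¬ (a = c ∧ b = d)) (hshare : a = c ∨ b = d) :
    IsContinuouslyOrdered (Circle.exp '' Ioo a b) (Circle.exp '' Ioo c d) := by
  refine ⟨⟨isConnected_exp_image_Ioo hab, isOpen_exp_image isOpen_Ioo,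
    isConnected_exp_image_Ioo (by linarith), isOpen_exp_image isOpen_Ioo,
    image_mono (Ioo_subset_Ioo hca hbd)⟩, ?_, (condA_arc_iff hcd hca hab hbd).mpr hshare,
    condB_of_arc hcd hca hab hbd⟩
  intro h
  exact hne ((exp_image_Ioo_eq_iff hab (by linarith) hca (by linarith) le_rfl (by linarith)).mp h)

/-- **Lemma 3.2 (vii)** (FrdII p. 26), PROVED: "Suppose that `A ≠ B`, `B ≠ S¹`. Then there exists an
`(A, B)`-subset `C` such that the pairs `(A, C)`; `(C, B)` are continuously ordered."
[cite: MochizukiFrdII2008, Lem 3.2 (vii) p.26] -/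
theorem ItemVII_holds : ItemVII := by
  intro A B hAB hne hB
  obtain ⟨c, d, hcd, hlen, rfl⟩ :=
    exists_eq_exp_image_Ioo hAB.isConnected_right hAB.isOpen_right hB
  have hcA : Circle.exp c ∉ A := fun h => exp_left_notMem_arc hlen (hAB.subset h)
  obtain ⟨a, b, hca, hab, hb2, rfl⟩ :=
    exists_eq_exp_image_Ioo_of_notMem hAB.isConnected_left hAB.isOpen_left hcA
  have hbd : b ≤ d :=
    ((exp_image_Ioo_subset_iff hab hca hb2 le_rfl (by linarith)).mp hAB.subset).2
  have hne' : ¬ (a = c ∧ b = d) := by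
    rintro ⟨rfl, rfl⟩
    exact hne rfl
  rcases lt_or_eq_of_le hca with hca' | hca'
  · rcases lt_or_eq_of_le hbd with hbd' | hbd'
    · -- `c < a`, `b < d`: `C = (c, b)`
      refine ⟨Circle.exp '' Ioo c b,
        (isSub_arc_iff hlen hca hab hbd).mpr ⟨c, b, le_rfl, hca, le_rfl, hbd, rfl⟩,
        isContinuouslyOrdered_arc (by linarith) hca hab le_rfl (fun h => hca'.ne' h.1) (Or.inr rfl),
        isContinuouslyOrdered_arc hlen le_rfl (by linarith) hbd (fun h => hbd'.ne h.2)
          (Or.inl rfl)⟩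
    · -- `c < a`, `b = d`: `C = ((c + a)/2, d)`
      subst hbd'
      refine ⟨Circle.exp '' Ioo ((c + a) / 2) b,
        (isSub_arc_iff hlen hca hab le_rfl).mpr
          ⟨(c + a) / 2, b, by linarith, by linarith, le_rfl, le_rfl, rfl⟩,
        isContinuouslyOrdered_arc (by linarith) (by linarith) hab le_rfl
          (fun h => by linarith [h.1]) (Or.inr rfl),
        isContinuouslyOrdered_arc hlen (by linarith) (by linarith) le_rfl
          (fun h => by linarith [h.1]) (Or.inr rfl)⟩
  · -- `c = a`, hence `b < d`: `C = (c, (b + d)/2)`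
    subst hca'
    have hbd' : b < d := lt_of_le_of_ne hbd fun h => hne' ⟨rfl, h⟩
    refine ⟨Circle.exp '' Ioo c ((b + d) / 2),
      (isSub_arc_iff hlen le_rfl hab hbd).mpr ⟨c, (b + d) / 2, le_rfl, le_rfl, by linarith,
        by linarith, rfl⟩,
      isContinuouslyOrdered_arc (by linarith) le_rfl hab (by linarith)
        (fun h => by linarith [h.2]) (Or.inl rfl),
      isContinuouslyOrdered_arc hlen le_rfl (by linarith) (by linarith)
        (fun h => by linarith [h.2]) (Or.inl rfl)⟩

end CircleOpens

end

end Literature.AlgebraicGeometry.Frobenioids
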